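import Literature.MathematicalPhysics.QuantumFieldTheory.Balaban1983to89.B7Eq136Coefficients
import Literature.MathematicalPhysics.QuantumFieldTheory.Balaban1983to89.B7Eq136Series

/-!
# `Balaban1983to89.B7Eq136SeriesTerms` — T. Bałaban, *Averaging operations for lattice gauge theories*, Commun. Math. Phys. **98** (1985)
17–51 [Balaban1985Averaging], (136) p. 39: **«C_k(U₀, A) = C_k^{(2)}(U₀, A) + C_k^{(3)}(U₀, A) + …» — THE TERMS OF ANY POWER SERIES OF
`A ↦ C_j(U₀, A)(c)` AT `0` ARE THE HOMOGENEOUS TERMS `C_j⁽ⁿ⁾` OF `B7Eq136Series`, AND THAT SERIES SUMS TO `C_j(U₀, A)(c)` ON THE WHOLE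
SUP-BALL OF THE WITNESS RADIUS** — the join of r04's power-series form of (136) (`B7Prop4GeneralCk.prop4_general_Ck_powerSeries`: a power
series `p` at `0` with `p₀ = p₁ = 0`, some radius), the bridge `B7Eq136Coefficients` (`p_n(A, …, A)` = the slice coefficient) and the
concrete convergent series `B7Eq136Series` (`Σ_n C_j⁽ⁿ⁾(U₀, B)(c) = C_j(U₀, B)(c)` for every bond field with `‖B‖_∞ < b`): for every such
`p` and every `A ∈ 𝔸^S` with `‖A‖_∞ < b`, `p_n(A, …, A) = C_j⁽ⁿ⁾(U₀, ins_S A)(c)` and `Σ_n p_n(A, …, A) = C_j(U₀, ins_S A)(c)` with the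
geometric tail bound — (136) for the power-series terms beyond the radius the abstract existence statement provides

statement-level skeleton of published theorems with citation tags; proofs where landed; nothing here is a claim about the Yang–Mills mass gap

v1.1 (p06 gen 8, 2026-08-21): DOCFIX ONLY — the p. 39 quotation after (136) re-quoted verbatim ((136) → «We will need some more precise
information about the function Q_k …» → (137)); the differential identities v1 printed inside the guillemets are relabelled as this seat's gloss
(ref-1 g42 F4 erratum); declarations byte-identical to v1 (p303719).

PDF held: `paper:balaban1985-cmp98-averaging` (journal page = PDF page + 16), renders `…/1985-cmp98-averaging-p022-x2.png`, `-p023-x2.png`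
(pp. 38–39; cell `b2b-balaban-ref1` page renders, re-read by this seat); `paper:balaban1985-cmp102-variational-background` p. 286 [PDF 10].

CITATION HEADER / WHAT IS REPRODUCED.  Cell `lit-balaban` (HOME `run/shared/lean/pub/lit-balaban/`), Phase-2 proof seat p06 gen 7 = unit
`lit-balaban-p06` (TAKING line HOME/STATUS.md 2026-08-21T20:22:59Z; successor item (o′) of HANDOFF.md § lit-balaban-p06 GEN 6); SKELETON rows
**B7.Prop4 / B7.Eq127** (display (136); owner r04: «(136) @gen PROVED as the existence of a power series with p₀ = p₁ = 0» p247904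
`B7Prop4GeneralCk`, «terms identified on the diagonal» p297510 `B7Eq136Coefficients`, «(136) as a convergent series» p292858 `B7Eq136Series`)
and **B11.Eq55** ((56) «Σ_{n=2}^∞ C_j^{(n)}(…)», owner r08).  THE PRINT, [B7] p. 39 (render `…-p023-x2.png` re-read; v1.1 re-quotation,
ref-1 g42 F4 erratum 2026-08-21T22:02Z): *«The function C_k can be decomposed further into a sum of homogeneous polynomials, C_k(U₀, A) =
C_k^{(2)}(U₀, A) + C_k^{(3)}(U₀, A) + … . (136) We will need some more precise information about the function Q_k. This information is connected
with a notion of the functional derivative. Let us recall this notion. If F(A) is a differentiable function defined at field configurations A on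
Ω, then the differential dF(A, δA) = (d/dt)F(A + tδA)|_{t=0} (137) is a linear functional of the variable δA and can be represented as a scalar
product of δA and some Lie algebra valued function.»*  SEAT'S GLOSS, NOT PRINT (v1 of this header presented it inside the quotation — withdrawn):
reading the homogeneous terms of (136) as the Taylor terms of the analytic map A ↦ C_k(U₀, A) computed with the differential (137) along slices
t ↦ A + tδA (so that, e.g., the second-order term is ½d²C_k(U₀, 0; A, A)) is this seat's identification, which the theorems below PROVE for the
concrete C_j (`powerSeries_diag_eq_CCovIterN`); [B7] prints no such identity after (136).  The radius statement below (the whole sup-ball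
`‖A‖_∞ < b` of Prop. 4's witness radius) is printed nowhere either; it is what `B7Eq136Series` proves for the concrete `C_j`.

DICTIONARY.  As `B7Eq136Coefficients` / `B7Eq136Series`: `C_j(U₀, B)(c)` ↦ `CCovIter L U₀ B j z κ` (`c = (z, κ)`); a finite set `S` of fine
bonds, `A ∈ 𝔸^S` inserted as the bond field `ins_S A = insCfg S A` on `ℤᵈ` (zero off `S`); `C_j⁽ⁿ⁾(U₀, B)(c)` ↦ `CCovIterN L U₀ B j z κ n`;
`p` ANY `FormalMultilinearSeries ℂ (S → 𝔸) 𝔸` with `HasFPowerSeriesAt (A ↦ C_j(U₀, ins_S A)(c)) p 0`; print's `C₂` of (135) ↦ `8·C₁·e^{4cα₀}`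
(written out; no notation in this file).  Regime (§2) = `B7Eq136Series`'s (`L ≥ 2`, `AvgClosed` structure group, (52) `pdev U₀ < α₀L^{−2k}`,
`C₀α₀ ≤ ⅓`, `4α₀ ≤ c₂′`, witness radius `b > 0` with `hsmall`, `2Lᵏb ≤ c₃`), `j ≤ k`.

WHAT THIS FILE PROVES (theorems only; kernel, 0 sorry, standard axioms):
* §1 (no regime) **`powerSeries_diag_eq_CCovIterN`** (`p_n(A, …, A) = C_j⁽ⁿ⁾(U₀, ins_S A)(c)` for every `p`, `A`, `n`),
  `powerSeries_partialSum_diag` (`Σ_{n<N} p_n(A, …, A) = Σ_{n<N} C_j⁽ⁿ⁾(U₀, ins_S A)(c)`).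
* §2 (regime, `j ≤ k`) **`hasSum_powerSeries_diag`** (for `‖A‖_∞ < b`: `Σ_n p_n(A, …, A) = C_j(U₀, ins_S A)(c)` — (136) for the terms of ANY
  power series at `0`, on the whole sup-ball of radius `b`), `CCovIter_ins_eq_tsum_powerSeries_diag`, **`norm_CCovIter_ins_sub_powerSeries_partialSum_le`**
  (`‖C_j(U₀, ins_S A)(c) − Σ_{n<N} p_n(A, …, A)‖ ≤ C₂(Lʲ)²b²(β/b)ᴺ(1 − β/b)⁻¹` for `‖A_s‖ ≤ β < b`), `norm_powerSeries_diag_le` (Cauchy: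
  `‖p_n(A, …, A)‖ ≤ C₂(Lʲ)²b²(β/b)ⁿ`), `powerSeries_diag_zero_one` (`p₀() = 0`, `p₁(A) = 0` on the diagonal for ANY such `p` — (134)/(135)).
* §3 (r04's regime at the top level `k`) **`prop4_general_Ck_powerSeries_hasSum`**: r04's power series of `A ↦ C_k(U₀, A)(c)` EXISTS with
  `p₀ = p₁ = 0`, its diagonal terms ARE the `C_k⁽ⁿ⁾`, and they SUM to `C_k(U₀, ins_S A)(c)` for every `‖A‖_∞ < ρ` — (136) at a general regular
  background with existence, identification and convergence in one statement.
NOT CLAIMED: off-diagonal values `p_n(A₁, …, A_n)` (polarizations; orders 2, 3 in `B7Eq136SecondOrder`/`B7Eq136ThirdPolarization`), convergence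
of the FULL multivariate series beyond its own radius, optimality of constants.  NOT summit progress.
-/

noncomputable section

open scoped BigOperators Topology
open NormedSpace Finset Metric Filter

namespace Literature.MathematicalPhysics.QuantumFieldTheory.Balaban1983to89.B7Eq136SeriesTerms

open B7Prop1Explicit B7Prop1Local B7Prop2Explicit B7Prop3Flat B7Prop4Flat B7Eq92Concrete B7Prop3GeneralLinear
  B7Prop4GeneralLevels B7Prop5GeneralInduction B7Prop5GeneralLevels B7Eq136SecondOrder B7Eq136Expansion B7Eq136ThirdOrder
  B7Eq136Coefficients B7Eq136Series
open B7Prop5FlatOperator (norm_insCfg_le_of_le)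

-- `Site` alone would resolve to the torus sites of `Setup.lean`; re-export the `ℤ^d` sites of `B7Prop1Explicit`.
export B7Prop1Explicit (Site)

variable {d : ℕ}

/-! ## §1 The diagonal terms of any power series are the `C_j⁽ⁿ⁾` (no regime) -/

section Bridge

variable {𝔸 : Type*} [NormedRing 𝔸] [NormedAlgebra ℂ 𝔸] [CompleteSpace 𝔸]

/-- **`p_n(A, …, A) = C_j⁽ⁿ⁾(U₀, ins_S A)(c)`**: the `n`-th term of ANY power series of `A ↦ C_j(U₀, ins_S A)(c)` at `0`, on the diagonal, is the
homogeneous term of order `n` of (136) (`B7Eq136Series.CCovIterN`, the `tⁿ`-coefficient of the slice (137)); no regime hypothesis.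
[cite: Balaban1985Averaging, (136) p.39, (137) p.39] -/
theorem powerSeries_diag_eq_CCovIterN (S : Finset (Site d × Fin d)) (L : ℕ) (U₀ : Site d → Fin d → 𝔸ˣ) (j : ℕ) (z : Site d) (κ : Fin d)
    {p : FormalMultilinearSeries ℂ (S → 𝔸) 𝔸} (hp : HasFPowerSeriesAt (fun a : S → 𝔸 => CCovIter L U₀ (insCfg S a) j z κ) p 0)
    (a : S → 𝔸) (n : ℕ) :
    p n (fun _ => a) = CCovIterN L U₀ (insCfg S a) j z κ n := by
  rw [CCovIterN_def]
  exact powerSeries_diag_eq_slice_coeff S L U₀ j z κ hp a n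

/-- partial sums on the diagonal: `Σ_{n<N} p_n(A, …, A) = Σ_{n<N} C_j⁽ⁿ⁾(U₀, ins_S A)(c)`. [cite: Balaban1985Averaging, (136) p.39] -/
theorem powerSeries_partialSum_diag (S : Finset (Site d × Fin d)) (L : ℕ) (U₀ : Site d → Fin d → 𝔸ˣ) (j : ℕ) (z : Site d) (κ : Fin d)
    {p : FormalMultilinearSeries ℂ (S → 𝔸) 𝔸} (hp : HasFPowerSeriesAt (fun a : S → 𝔸 => CCovIter L U₀ (insCfg S a) j z κ) p 0)
    (a : S → 𝔸) (N : ℕ) :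
    ∑ n ∈ Finset.range N, p n (fun _ => a) = ∑ n ∈ Finset.range N, CCovIterN L U₀ (insCfg S a) j z κ n :=
  Finset.sum_congr rfl fun n _ => powerSeries_diag_eq_CCovIterN S L U₀ j z κ hp a n

end Bridge

/-! ## §2 In the regime: the diagonal series of any power series sums to `C_j` on the whole sup-ball `‖A‖_∞ < b` -/

section Regime

variable {𝔸 : Type*} [NormedRing 𝔸] [NormedAlgebra ℂ 𝔸] [CompleteSpace 𝔸] [NormOneClass 𝔸]

variable (L : ℕ) (hL : 2 ≤ L) {G : Subgroup 𝔸ˣ} (hG : AvgClosed d L G) (k : ℕ)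
  (U₀ : Site d → Fin d → 𝔸ˣ) (hU₀ : ∀ x κ, U₀ x κ ∈ G) {α₀ : ℝ} (hα : 0 < α₀)
  (hα3 : C0 d * α₀ ≤ 1 / 3) (hα4 : 4 * α₀ ≤ c2' d L) (h52 : pdev U₀ < α₀ * (((L : ℝ) ^ k)⁻¹) ^ 2)
  {b : ℝ} (hb : 0 < b)
  (hsmall : Real.exp (4 * (800 * ((d : ℝ) + 1) ^ 2 * ((d : ℝ) + 4)) * α₀)
    * (1 + 8 * (131072 * ((d : ℝ) + 1) ^ 2) * ((L : ℝ) ^ k * b)) ≤ 2)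
  (hc₃ : 2 * ((L : ℝ) ^ k * b) ≤ c3 d L) (S : Finset (Site d × Fin d))

include hL hG hU₀ hα hα3 hα4 h52 hb hsmall hc₃ in
/-- **(136) FOR THE TERMS OF ANY POWER SERIES, ON THE WHOLE SUP-BALL**: if `p` is a power series of `A ↦ C_j(U₀, ins_S A)(c)` at `0` (any radius)
and `‖A_s‖ ≤ β` for all `s ∈ S` with `0 < β < b`, then `Σ_n p_n(A, …, A) = C_j(U₀, ins_S A)(c)` — «C_k(U₀, A) = C_k^{(2)}(U₀, A) + C_k^{(3)}(U₀, A) +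
…» (`B7Eq136Series.hasSum_CCovIterN` for the bond field `ins_S A`, terms identified by §1). [cite: Balaban1985Averaging, (136) p.39]
[cite: Balaban1985Variational, (56) p.286] -/
theorem hasSum_powerSeries_diag_of_le {j : ℕ} (hj : j ≤ k) (z : Site d) (κ : Fin d)
    {p : FormalMultilinearSeries ℂ (S → 𝔸) 𝔸} (hp : HasFPowerSeriesAt (fun a : S → 𝔸 => CCovIter L U₀ (insCfg S a) j z κ) p 0)
    {a : S → 𝔸} {β : ℝ} (hβ : 0 < β) (ha : ∀ s, ‖a s‖ ≤ β) (hβb : β < b) :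
    HasSum (fun n : ℕ => p n (fun _ => a)) (CCovIter L U₀ (insCfg S a) j z κ) := by
  have hB : ∀ x κ', ‖insCfg S a x κ'‖ ≤ β := fun x κ' => norm_insCfg_le_of_le hβ.le ha x κ'
  have h := hasSum_CCovIterN L hL hG k U₀ hU₀ hα hα3 hα4 h52 hb hsmall hc₃ hβ hB hj z κ hβb
  have hfun : (fun n : ℕ => p n (fun _ => a)) = fun n : ℕ => CCovIterN L U₀ (insCfg S a) j z κ n :=
    funext fun n => powerSeries_diag_eq_CCovIterN S L U₀ j z κ hp a n
  rw [hfun]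
  exact h

include hL hG hU₀ hα hα3 hα4 h52 hb hsmall hc₃ in
/-- **(136) FOR THE TERMS OF ANY POWER SERIES, FOR EVERY `A ∈ 𝔸^S` WITH `‖A‖_∞ < b`**: `Σ_n p_n(A, …, A) = C_j(U₀, ins_S A)(c)` (the previous
theorem at `β = (‖A‖ + b)/2`). [cite: Balaban1985Averaging, (136) p.39] -/
theorem hasSum_powerSeries_diag {j : ℕ} (hj : j ≤ k) (z : Site d) (κ : Fin d)
    {p : FormalMultilinearSeries ℂ (S → 𝔸) 𝔸} (hp : HasFPowerSeriesAt (fun a : S → 𝔸 => CCovIter L U₀ (insCfg S a) j z κ) p 0)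
    {a : S → 𝔸} (ha : ‖a‖ < b) :
    HasSum (fun n : ℕ => p n (fun _ => a)) (CCovIter L U₀ (insCfg S a) j z κ) := by
  have hβ : 0 < (‖a‖ + b) / 2 := by positivity
  have ha' : ∀ s, ‖a s‖ ≤ (‖a‖ + b) / 2 := fun s => (norm_le_pi_norm a s).trans (by linarith)
  have hβb : (‖a‖ + b) / 2 < b := by linarith
  exact hasSum_powerSeries_diag_of_le L hL hG k U₀ hU₀ hα hα3 hα4 h52 hb hsmall hc₃ S hj z κ hp hβ ha' hβb

include hL hG hU₀ hα hα3 hα4 h52 hb hsmall hc₃ in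
/-- (136) in `tsum` form for the power-series terms: `C_j(U₀, ins_S A)(c) = Σ'_n p_n(A, …, A)` for `‖A‖_∞ < b`. [cite: Balaban1985Averaging, (136) p.39] -/
theorem CCovIter_ins_eq_tsum_powerSeries_diag {j : ℕ} (hj : j ≤ k) (z : Site d) (κ : Fin d)
    {p : FormalMultilinearSeries ℂ (S → 𝔸) 𝔸} (hp : HasFPowerSeriesAt (fun a : S → 𝔸 => CCovIter L U₀ (insCfg S a) j z κ) p 0)
    {a : S → 𝔸} (ha : ‖a‖ < b) :
    CCovIter L U₀ (insCfg S a) j z κ = ∑' n : ℕ, p n (fun _ => a) :=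
  (hasSum_powerSeries_diag L hL hG k U₀ hU₀ hα hα3 hα4 h52 hb hsmall hc₃ S hj z κ hp ha).tsum_eq.symm

include hL hG hU₀ hα hα3 hα4 h52 hb hsmall hc₃ in
/-- **THE REMAINDER OF (136) AFTER ANY ORDER, FOR THE POWER-SERIES TERMS**: for `‖A_s‖ ≤ β < b`, `0 < β`, and every `N`,
`‖C_j(U₀, ins_S A)(c) − Σ_{n<N} p_n(A, …, A)‖ ≤ C₂(Lʲ)²b²·(β/b)ᴺ·(1 − β/b)⁻¹` (`B7Eq136Series.norm_CCovIter_sub_partialSum_le`, terms identified).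
[cite: Balaban1985Averaging, (136) p.39, (135) p.38] -/
theorem norm_CCovIter_ins_sub_powerSeries_partialSum_le {j : ℕ} (hj : j ≤ k) (z : Site d) (κ : Fin d)
    {p : FormalMultilinearSeries ℂ (S → 𝔸) 𝔸} (hp : HasFPowerSeriesAt (fun a : S → 𝔸 => CCovIter L U₀ (insCfg S a) j z κ) p 0)
    {a : S → 𝔸} {β : ℝ} (hβ : 0 < β) (ha : ∀ s, ‖a s‖ ≤ β) (hβb : β < b) (N : ℕ) :
    ‖CCovIter L U₀ (insCfg S a) j z κ - ∑ n ∈ Finset.range N, p n (fun _ => a)‖ ≤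
      (8 * (131072 * ((d : ℝ) + 1) ^ 2) * Real.exp (4 * (800 * ((d : ℝ) + 1) ^ 2 * ((d : ℝ) + 4)) * α₀))
        * ((L : ℝ) ^ j) ^ 2 * b ^ 2 * (β / b) ^ N * (1 - β / b)⁻¹ := by
  have hB : ∀ x κ', ‖insCfg S a x κ'‖ ≤ β := fun x κ' => norm_insCfg_le_of_le hβ.le ha x κ'
  rw [powerSeries_partialSum_diag S L U₀ j z κ hp a N]
  exact norm_CCovIter_sub_partialSum_le L hL hG k U₀ hU₀ hα hα3 hα4 h52 hb hsmall hc₃ hβ hB hj z κ hβb N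

include hL hG hU₀ hα hα3 hα4 h52 hb hsmall hc₃ in
/-- **CAUCHY'S BOUND FOR THE POWER-SERIES TERMS ON THE DIAGONAL**: for `‖A_s‖ ≤ β`, `0 < β`, every `n`:
`‖p_n(A, …, A)‖ ≤ C₂(Lʲ)²b²·(β/b)ⁿ` (`B7Eq136Series.norm_CCovIterN_le`). [cite: Balaban1985Averaging, (136) p.39, (135) p.38] -/
theorem norm_powerSeries_diag_le {j : ℕ} (hj : j ≤ k) (z : Site d) (κ : Fin d)
    {p : FormalMultilinearSeries ℂ (S → 𝔸) 𝔸} (hp : HasFPowerSeriesAt (fun a : S → 𝔸 => CCovIter L U₀ (insCfg S a) j z κ) p 0)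
    {a : S → 𝔸} {β : ℝ} (hβ : 0 < β) (ha : ∀ s, ‖a s‖ ≤ β) (n : ℕ) :
    ‖p n (fun _ => a)‖ ≤
      (8 * (131072 * ((d : ℝ) + 1) ^ 2) * Real.exp (4 * (800 * ((d : ℝ) + 1) ^ 2 * ((d : ℝ) + 4)) * α₀))
        * ((L : ℝ) ^ j) ^ 2 * b ^ 2 * (β / b) ^ n := by
  have hB : ∀ x κ', ‖insCfg S a x κ'‖ ≤ β := fun x κ' => norm_insCfg_le_of_le hβ.le ha x κ'
  rw [powerSeries_diag_eq_CCovIterN S L U₀ j z κ hp a n]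
  exact norm_CCovIterN_le L hL hG k U₀ hU₀ hα hα3 hα4 h52 hb hsmall hc₃ hβ hB hj z κ n

include hL hG hU₀ hα hα3 hα4 h52 hb hsmall hc₃ in
/-- **(134)/(135) FOR ANY POWER SERIES: NO TERMS OF ORDERS `0` AND `1` ON THE DIAGONAL** — `p₀() = 0` and `p₁(A) = 0` for every `A ∈ 𝔸^S`
(`B7Eq136Series.CCovIterN_zero`/`_one` for the bond field `ins_S A`; r04's `prop4_general_Ck_powerSeries` has `p₀ = p₁ = 0` for ITS series, here
for every one). [cite: Balaban1985Averaging, (134)–(136) pp.38–39] -/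
theorem powerSeries_diag_zero_one {j : ℕ} (hj : j ≤ k) (z : Site d) (κ : Fin d)
    {p : FormalMultilinearSeries ℂ (S → 𝔸) 𝔸} (hp : HasFPowerSeriesAt (fun a : S → 𝔸 => CCovIter L U₀ (insCfg S a) j z κ) p 0)
    (a : S → 𝔸) : p 0 (fun _ => a) = 0 ∧ p 1 (fun _ => a) = 0 := by
  have hβ : 0 < ‖a‖ + 1 := by positivity
  have ha : ∀ s, ‖a s‖ ≤ ‖a‖ + 1 := fun s => (norm_le_pi_norm a s).trans (by linarith)
  have hB : ∀ x κ', ‖insCfg S a x κ'‖ ≤ ‖a‖ + 1 := fun x κ' => norm_insCfg_le_of_le hβ.le ha x κ'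
  rw [powerSeries_diag_eq_CCovIterN S L U₀ j z κ hp a 0, powerSeries_diag_eq_CCovIterN S L U₀ j z κ hp a 1]
  exact ⟨CCovIterN_zero L hL hG k U₀ hU₀ hα hα3 hα4 h52 hb hsmall hc₃ hβ hB hj z κ,
    CCovIterN_one L hL hG k U₀ hU₀ hα hα3 hα4 h52 hb hsmall hc₃ hβ hB hj z κ⟩

end Regime

/-! ## §3 (136) at a general background, top level: existence, identification and convergence in one statement -/

section TopLevel

variable {𝔸 : Type*} [NormedRing 𝔸] [NormedAlgebra ℂ 𝔸] [CompleteSpace 𝔸] [NormOneClass 𝔸]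

/-- **(136) AT A GENERAL REGULAR BACKGROUND — r04's POWER SERIES WITH ITS TERMS IDENTIFIED AND SUMMED**: in the regime of
`B7Prop4GeneralCk.prop4_general_Ck_powerSeries` (= that of `B7Eq136Series` at the top level `k` with the witness radius `ρ`), the functional
`A ↦ C_k(U₀, A)(c)` on `𝔸^S` has a power series `p` at `0` with `p₀ = 0`, `p₁ = 0`, whose diagonal terms ARE the homogeneous polynomials
`p_n(A, …, A) = C_k⁽ⁿ⁾(U₀, ins_S A)(c)` of (136), and for every `A` with `‖A‖_∞ < ρ` these terms SUM to `C_k(U₀, ins_S A)(c)` — «C_k(U₀, A) =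
C_k^{(2)}(U₀, A) + C_k^{(3)}(U₀, A) + …». [cite: Balaban1985Averaging, (136) p.39, Prop. 4 p.38] -/
theorem prop4_general_Ck_powerSeries_hasSum (S : Finset (Site d × Fin d)) (L : ℕ) (hL : 2 ≤ L) {G : Subgroup 𝔸ˣ}
    (hG : AvgClosed d L G) (k : ℕ) (U₀ : Site d → Fin d → 𝔸ˣ) (hU₀ : ∀ x κ, U₀ x κ ∈ G) {α₀ : ℝ}
    (hα : 0 < α₀) (hα3 : C0 d * α₀ ≤ 1 / 3) (hα4 : 4 * α₀ ≤ c2' d L) (h52 : pdev U₀ < α₀ * (((L : ℝ) ^ k)⁻¹) ^ 2)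
    {ρ : ℝ} (hρ : 0 < ρ)
    (hρsmall : Real.exp (4 * (800 * ((d : ℝ) + 1) ^ 2 * ((d : ℝ) + 4)) * α₀)
      * (1 + 8 * (131072 * ((d : ℝ) + 1) ^ 2) * ((L : ℝ) ^ k * ρ)) ≤ 2)
    (hρc₃ : 2 * ((L : ℝ) ^ k * ρ) ≤ c3 d L) (z : Site d) (κ : Fin d) :
    ∃ p : FormalMultilinearSeries ℂ (S → 𝔸) 𝔸,
      HasFPowerSeriesAt (fun a : S → 𝔸 => CCovIter L U₀ (insCfg S a) k z κ) p 0 ∧ p 0 = 0 ∧ p 1 = 0 ∧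
        (∀ (a : S → 𝔸) (n : ℕ), p n (fun _ => a) = CCovIterN L U₀ (insCfg S a) k z κ n) ∧
        ∀ a : S → 𝔸, ‖a‖ < ρ → HasSum (fun n : ℕ => p n (fun _ => a)) (CCovIter L U₀ (insCfg S a) k z κ) := by
  obtain ⟨p, hp, h0, h1, -⟩ := prop4_general_Ck_powerSeries_terms S L hL hG k U₀ hU₀ hα hα3 hα4 h52 hρ hρsmall hρc₃ z κ
  exact ⟨p, hp, h0, h1, fun a n => powerSeries_diag_eq_CCovIterN S L U₀ k z κ hp a n,
    fun a ha => hasSum_powerSeries_diag L hL hG k U₀ hU₀ hα hα3 hα4 h52 hρ hρsmall hρc₃ S le_rfl z κ hp ha⟩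

end TopLevel

end Literature.MathematicalPhysics.QuantumFieldTheory.Balaban1983to89.B7Eq136SeriesTerms

end
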